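import Summits.ResolutionOfSingularities.ResolutionOfSingularities.Theorems.WildConesCampaignW46HypersurfacesCharTwoFourfoldThreeTangents

/-!
# [OURS · L1 W4.6, rung (ii) at p = 2, n = 4] THE FOURFOLD MULTIPLE-TANGENT WITNESS `z² = u₀u₁ + u₂²u₃ + u₂u₃⁴`: an
# ORDER-2-CLEANED isolated double point of a fourfold hypersurface in the class `(e, h₂) = (2, 2)`, with ONE
# satellite (`e₃`, corank-two isolated successor) AND ONE free near double point (`e₂`) — the `(2,2)` branch of
# `CampaignW46FourfoldsOrdTwoCensus` inhabited with both bounds attained, over every field of characteristic 2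

HONEST FRAMING. Everything here is OURS: theorems about route WildCones' own TYPED point-blow-up dynamics
(`Theorems/WildConesClassicalRegimesDefs.lean`) and the seat's invariants `polarMatrix` (p502936), `milnorEmbDim`
(p498937), `milnorHilbertTwo` (p511581), `degForm` (p522667). NOTHING here is a statement of the manuscript
[Hironaka2017]; no FACT-LIST premise; AI review is weaker than expert review. Cell res-hironaka (LADDER-RESOLUTION
rung L, D-0089), slot W4.6, seat res-L1-s46-pv-4 (gen 6); host route `WildCones`, crux `ClassicalRegimes`
(stmt-ResolutionOfSingularities-16884; proved).

THE WITNESS. `a = u₀u₁ + u₂²u₃ + u₂u₃⁴`: hyperbolic pair `u₀u₁` (`OrdP`), in characteristic two `∂a = (u₁, u₀, u₃⁴, u₂²)`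
so `𝔪⁵ ≤ (∂a)` (ISOLATED); kernel plane `{v₀ = v₁ = 0}`; polars `polar(λ, v) = λ₃v₂²` on the kernel, so `e₂` is a
non-zero null polar and `polar(e₃, e₂) = 1`: `h₂ = 2` by the null-polar criterion (p542945), `e = 2`; tangent cubic
`a₃(w) = w₂²w₃` (`s²t` on the kernel plane): the double root `e₃` is the SATELLITE (all kernel polars vanish there;
corank-two isolated successor with smaller `μ`), the simple root `e₂` is FREE (corank `0`). By the census (p544683)
there are no other near double points.

WHAT IS PROVED: `coeff_fourTangent`, `multP_of_ser_eq_fourTangent`, `ordP_of_ser_eq_fourTangent`, `pderiv_fourTangent`,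
`maximalIdeal_pow_five_le_jac_fourTangent`, `isol_of_ser_eq_fourTangent`, `vecMul_polarMatrix_fourTangent_of_kernel`,
`degForm_three_fourTangent`, `polar_fourTangent`, `fourTangent_near_points` (invariants + satellite + free point),
`fourfold_multipleTangent_witness` (existence over every field of characteristic `2`).

References: [CasasAlvero2000] §3 (context only); [GreuelPfister2026] Thm 3.5 / Cor 3.7 (context);
[Hironaka2017] Th. 16.6 p.84 — role replaced only, under adjudication; nothing of it is used.
-/

noncomputable section

-- single-problem summit: the doubled namespace component `ResolutionOfSingularities` is forced
set_option linter.dupNamespace false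

open scoped BigOperators Classical

open MvPowerSeries IsLocalRing

open Literature.AlgebraicGeometry.Resolution

namespace Summit.ResolutionOfSingularities.ResolutionOfSingularities.Theorems

namespace CampaignW46.HypersurfacesCharTwo

open WildCones WildCones.MuDropCharTwoOrdP ThreefoldsCharTwo

variable {κ : Type} [Field κ]

/-! ## The series `u₀u₁ + u₂²u₃ + u₂u₃⁴` -/

/-- [OURS · L1 W4.6] Coefficients of `X₀X₁ + X₂²X₃ + X₂X₃⁴`. [folklore] -/
theorem coeff_fourTangent (A : Fin 4 →₀ ℕ) :
    coeff A ((X 0 * X 1 + X 2 ^ 2 * X 3 + X 2 * X 3 ^ 4 : MvPowerSeries (Fin 4) κ)) =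
      (if A = Finsupp.single 0 1 + Finsupp.single 1 1 then 1 else 0) +
        (if A = Finsupp.single 2 2 + Finsupp.single 3 1 then 1 else 0) +
        (if A = Finsupp.single 2 1 + Finsupp.single 3 4 then 1 else 0) := by
  rw [map_add, map_add, X_pow_eq, X_pow_eq, X_def, X_def, X_def, X_def, monomial_mul_monomial,
    monomial_mul_monomial, monomial_mul_monomial, one_mul, coeff_monomial, coeff_monomial, coeff_monomial]

/-- [OURS · L1 W4.6] No monomial of `X₀X₁ + X₂²X₃ + X₂X₃⁴` has all exponents even. [folklore] -/
theorem fourTangent_coeff_eq_zero_of_even (A : Fin 4 →₀ ℕ) (hA : ∀ j, 2 ∣ A j) :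
    coeff A ((X 0 * X 1 + X 2 ^ 2 * X 3 + X 2 * X 3 ^ 4 : MvPowerSeries (Fin 4) κ)) = 0 := by
  rw [coeff_fourTangent]
  have h0 : A ≠ Finsupp.single 0 1 + Finsupp.single 1 1 := by
    rintro rfl; have := hA 0; simp at this
  have h1 : A ≠ Finsupp.single 2 2 + Finsupp.single 3 1 := by
    rintro rfl; have := hA 3; simp at this
  have h2 : A ≠ Finsupp.single 2 1 + Finsupp.single 3 4 := by
    rintro rfl; have := hA 2; simp at this
  rw [if_neg h0, if_neg h1, if_neg h2]
  simp

/-- [OURS · L1 W4.6] The pair coefficient `[X₀X₁]` is `1`. [folklore] -/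
theorem coeff_pair_fourTangent :
    coeff (Finsupp.single 0 1 + Finsupp.single 1 1)
      ((X 0 * X 1 + X 2 ^ 2 * X 3 + X 2 * X 3 ^ 4 : MvPowerSeries (Fin 4) κ)) = 1 := by
  rw [coeff_fourTangent, if_pos rfl]
  have h1 : (Finsupp.single 0 1 + Finsupp.single 1 1 : Fin 4 →₀ ℕ) ≠ Finsupp.single 2 2 + Finsupp.single 3 1 := by
    intro h'; have := DFunLike.congr_fun h' 0; simp at this
  have h2 : (Finsupp.single 0 1 + Finsupp.single 1 1 : Fin 4 →₀ ℕ) ≠ Finsupp.single 2 1 + Finsupp.single 3 4 := by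
    intro h'; have := DFunLike.congr_fun h' 0; simp at this
  rw [if_neg h1, if_neg h2]
  simp

/-- [OURS · L1 W4.6] A state (`n = 4`) with cleaned series `u₀u₁ + u₂²u₃ + u₂u₃⁴` is a double point. [folklore] -/
theorem multP_of_ser_eq_fourTangent {c : (Fin 4 → ℕ) → κ}
    (hc : ser 2 4 κ c = X 0 * X 1 + X 2 ^ 2 * X 3 + X 2 * X 3 ^ 4) : MultP 2 4 κ c := by
  rw [multP_iff_ser, hc]
  constructor
  · intro h
    have h1 := congrArg (coeff (Finsupp.single (0 : Fin 4) 1 + Finsupp.single 1 1)) h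
    rw [coeff_pair_fourTangent, map_zero] at h1
    exact one_ne_zero h1
  · refine nat_le_order fun d hd => ?_
    rw [coeff_fourTangent]
    have h0 : d ≠ Finsupp.single 0 1 + Finsupp.single 1 1 := by
      rintro rfl; simp only [map_add, Finsupp.degree_single] at hd; omega
    have h1 : d ≠ Finsupp.single 2 2 + Finsupp.single 3 1 := by
      rintro rfl; simp only [map_add, Finsupp.degree_single] at hd; omega
    have h2 : d ≠ Finsupp.single 2 1 + Finsupp.single 3 4 := by
      rintro rfl; simp only [map_add, Finsupp.degree_single] at hd; omega
    rw [if_neg h0, if_neg h1, if_neg h2]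
    simp

/-- [OURS · L1 W4.6] … and order-2 cleaned (`u₀u₁`). [folklore] -/
theorem ordP_of_ser_eq_fourTangent {c : (Fin 4 → ℕ) → κ}
    (hc : ser 2 4 κ c = X 0 * X 1 + X 2 ^ 2 * X 3 + X 2 * X 3 ^ 4) : OrdP 2 4 κ c := by
  rw [ordP_two_iff_exists_pair, hc]
  exact ⟨0, 1, by decide, by rw [coeff_pair_fourTangent]; exact one_ne_zero⟩

/-! ## Partials and isolatedness -/

/-- [OURS · L1 W4.6] In characteristic two: `∂₀a = X₁`, `∂₁a = X₀`, `∂₂a = X₃⁴`, `∂₃a = X₂²`. [folklore] -/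
theorem pderiv_fourTangent [CharP κ 2] (s : Fin 4) :
    MvPowerSeries.pderiv s ((X 0 * X 1 + X 2 ^ 2 * X 3 + X 2 * X 3 ^ 4 : MvPowerSeries (Fin 4) κ)) =
      if s = 0 then X 1 else if s = 1 then X 0 else if s = 2 then X 3 ^ 4 else X 2 ^ 2 := by
  have h2 : (2 : MvPowerSeries (Fin 4) κ) = 0 := by
    rw [← map_ofNat (C : κ →+* _) 2, CharTwo.two_eq_zero (R := κ), map_zero]
  have h4 : (4 : MvPowerSeries (Fin 4) κ) = 0 := by
    rw [show (4 : MvPowerSeries (Fin 4) κ) = 2 * 2 by norm_num, h2, mul_zero]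
  rw [map_add, map_add, Derivation.leibniz, Derivation.leibniz, Derivation.leibniz,
    Derivation.leibniz_pow, Derivation.leibniz_pow, MvPowerSeries.pderiv_X, MvPowerSeries.pderiv_X,
    MvPowerSeries.pderiv_X, MvPowerSeries.pderiv_X]
  fin_cases s <;> simp [smul_eq_mul, h2, h4]

/-- [OURS · L1 W4.6] `𝔪⁵ ≤ (∂a)`: a monomial of degree `5` in four variables is divisible by `X₀`, by `X₁`, by `X₂²`
or by `X₃⁴`. [folklore] -/
theorem maximalIdeal_pow_five_le_jac_fourTangent [CharP κ 2] :
    maximalIdeal (MvPowerSeries (Fin 4) κ) ^ 5 ≤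
      Ideal.span (Set.range fun s : Fin 4 =>
        MvPowerSeries.pderiv s ((X 0 * X 1 + X 2 ^ 2 * X 3 + X 2 * X 3 ^ 4 : MvPowerSeries (Fin 4) κ))) := by
  rw [Literature.RingTheory.MvPowerSeries.Jets.maximalIdeal_pow_eq_span_monomial, Ideal.span_le]
  rintro _ ⟨e, he, rfl⟩
  change e.degree = 5 at he
  change (monomial e (1 : κ) : MvPowerSeries (Fin 4) κ) ∈ _
  have mem_of : ∀ (s : Fin 4) (k : ℕ), k ≤ e s →
      (∃ s', (X s : MvPowerSeries (Fin 4) κ) ^ k = MvPowerSeries.pderiv s'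
        ((X 0 * X 1 + X 2 ^ 2 * X 3 + X 2 * X 3 ^ 4 : MvPowerSeries (Fin 4) κ))) →
      (monomial e (1 : κ) : MvPowerSeries (Fin 4) κ) ∈ Ideal.span (Set.range fun s : Fin 4 =>
        MvPowerSeries.pderiv s ((X 0 * X 1 + X 2 ^ 2 * X 3 + X 2 * X 3 ^ 4 : MvPowerSeries (Fin 4) κ))) := by
    rintro s k hk ⟨s', h⟩
    have hdec : (monomial e (1 : κ) : MvPowerSeries (Fin 4) κ) =
        monomial (e - Finsupp.single s k) (1 : κ) * X s ^ k := by
      rw [X_pow_eq, monomial_mul_monomial, one_mul, tsub_add_cancel_of_le]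
      intro t
      by_cases hts : t = s
      · subst hts; rwa [Finsupp.single_eq_same]
      · rw [Finsupp.single_apply, if_neg (Ne.symm hts)]; exact Nat.zero_le _
    rw [hdec]
    exact Ideal.mul_mem_left _ _ (Ideal.subset_span ⟨s', h.symm⟩)
  by_cases h0 : 1 ≤ e 0
  · exact mem_of 0 1 h0 ⟨1, by rw [pderiv_fourTangent]; simp⟩
  by_cases h1 : 1 ≤ e 1
  · exact mem_of 1 1 h1 ⟨0, by rw [pderiv_fourTangent]; simp⟩
  have hsum : e.degree = e 0 + e 1 + e 2 + e 3 := by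
    rw [degree_eq_sum_univ, Fin.sum_univ_four]
  by_cases h2 : 2 ≤ e 2
  · exact mem_of 2 2 h2 ⟨3, by rw [pderiv_fourTangent]; simp⟩
  have h3 : 4 ≤ e 3 := by omega
  exact mem_of 3 4 h3 ⟨2, by rw [pderiv_fourTangent]; simp⟩

/-- [OURS · L1 W4.6] **The state is ISOLATED**: `(∂a) ⊇ 𝔪⁵`. [folklore] -/
theorem isol_of_ser_eq_fourTangent [CharP κ 2] {c : (Fin 4 → ℕ) → κ}
    (hc : ser 2 4 κ c = X 0 * X 1 + X 2 ^ 2 * X 3 + X 2 * X 3 ^ 4) : Isol 2 4 κ c := by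
  rw [isol_iff_finite_pderiv, hc]
  haveI := Literature.RingTheory.MvPowerSeries.Jets.finite_quotient_maximalIdeal_pow
    (σ := Fin 4) (K := κ) 5
  exact Module.Finite.of_surjective
    (Ideal.Quotient.factorₐ κ maximalIdeal_pow_five_le_jac_fourTangent).toLinearMap
    (Ideal.Quotient.factor_surjective maximalIdeal_pow_five_le_jac_fourTangent)

/-! ## Kernel, polars, tangent cubic -/

/-- [OURS · L1 W4.6] Rows `2` and `3` of the polar matrix of `u₀u₁ + u₂²u₃ + u₂u₃⁴` vanish. [folklore] -/
theorem polarMatrix_fourTangent_row_eq_zero (s t : Fin 4) (hs : s = 2 ∨ s = 3) :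
    polarMatrix ((X 0 * X 1 + X 2 ^ 2 * X 3 + X 2 * X 3 ^ 4 : MvPowerSeries (Fin 4) κ)) s t = 0 := by
  simp only [polarMatrix, Matrix.of_apply]
  by_cases hst : s = t
  · rw [if_pos hst]
  rw [if_neg hst, coeff_fourTangent]
  have h1 : (Finsupp.single s 1 + Finsupp.single t 1 : Fin 4 →₀ ℕ) ≠ Finsupp.single 0 1 + Finsupp.single 1 1 := by
    intro h
    have := DFunLike.congr_fun h s
    rcases hs with rfl | rfl <;> simp [Finsupp.single_apply] at this
  have h2 : (Finsupp.single s 1 + Finsupp.single t 1 : Fin 4 →₀ ℕ) ≠ Finsupp.single 2 2 + Finsupp.single 3 1 := by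
    intro h
    have hd := congrArg Finsupp.degree h
    simp only [map_add, Finsupp.degree_single] at hd
    omega
  have h3 : (Finsupp.single s 1 + Finsupp.single t 1 : Fin 4 →₀ ℕ) ≠ Finsupp.single 2 1 + Finsupp.single 3 4 := by
    intro h
    have hd := congrArg Finsupp.degree h
    simp only [map_add, Finsupp.degree_single] at hd
    omega
  rw [if_neg h1, if_neg h2, if_neg h3, add_zero, add_zero]

/-- [OURS · L1 W4.6] The kernel of the polar matrix contains `{v₀ = v₁ = 0}`. [folklore] -/
theorem vecMul_polarMatrix_fourTangent_of_kernel (v : Fin 4 → κ) (h0 : v 0 = 0) (h1 : v 1 = 0) :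
    Matrix.vecMul v (polarMatrix ((X 0 * X 1 + X 2 ^ 2 * X 3 + X 2 * X 3 ^ 4 : MvPowerSeries (Fin 4) κ))) = 0 := by
  funext t
  rw [Matrix.vecMul, dotProduct, Fin.sum_univ_four, h0, h1, zero_mul, zero_mul, zero_add, zero_add,
    polarMatrix_fourTangent_row_eq_zero 2 t (Or.inl rfl), polarMatrix_fourTangent_row_eq_zero 3 t (Or.inr rfl),
    mul_zero, mul_zero, add_zero, Pi.zero_apply]

/-- [OURS · L1 W4.6] The tangent cubic of `u₀u₁ + u₂²u₃ + u₂u₃⁴` is `w₂²w₃` (`s²t` on the kernel plane). [folklore] -/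
theorem degForm_three_fourTangent (w : Fin 4 → κ) :
    degForm 3 ((X 0 * X 1 + X 2 ^ 2 * X 3 + X 2 * X 3 ^ 4 : MvPowerSeries (Fin 4) κ)) w = w 2 ^ 2 * w 3 := by
  rw [X_pow_eq, X_pow_eq, X_def, X_def, X_def, X_def, monomial_mul_monomial, monomial_mul_monomial,
    monomial_mul_monomial, one_mul, degForm_add, degForm_add,
    degForm_monomial_of_ne (by rw [map_add, Finsupp.degree_single, Finsupp.degree_single]; norm_num),
    degForm_monomial (by rw [map_add, Finsupp.degree_single, Finsupp.degree_single]),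
    degForm_monomial_of_ne (by rw [map_add, Finsupp.degree_single, Finsupp.degree_single]; norm_num),
    Fin.prod_univ_four]
  simp

/-- [OURS · L1 W4.6] THE POLARS of `u₀u₁ + u₂²u₃ + u₂u₃⁴`: for EVERY `λ`, `Σₛ λₛ (∂ₛa)₂(v) = λ₃ v₂²` (the degree-two
forms of `∂₀a = u₁`, `∂₁a = u₀`, `∂₂a = u₃⁴` vanish; `(u₂²)₂ = v₂²`). [folklore] -/
theorem polar_fourTangent [CharP κ 2] (lam v : Fin 4 → κ) :
    ∑ s, lam s * degForm 2 (MvPowerSeries.pderiv s ((X 0 * X 1 + X 2 ^ 2 * X 3 + X 2 * X 3 ^ 4 : MvPowerSeries (Fin 4) κ))) v =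
      lam 3 * v 2 ^ 2 := by
  have hX : ∀ j : Fin 4, degForm 2 (X j : MvPowerSeries (Fin 4) κ) v = 0 := fun j => by
    rw [X_def, degForm_monomial_of_ne (by rw [Finsupp.degree_single]; norm_num)]
  have h3q : degForm 2 ((X 3 : MvPowerSeries (Fin 4) κ) ^ 4) v = 0 := by
    rw [X_pow_eq, degForm_monomial_of_ne (by rw [Finsupp.degree_single]; norm_num)]
  have h2sq : degForm 2 ((X 2 : MvPowerSeries (Fin 4) κ) ^ 2) v = v 2 ^ 2 := by
    rw [X_pow_eq, degForm_monomial (by rw [Finsupp.degree_single]), Fin.prod_univ_four]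
    simp
  rw [Fin.sum_univ_four, pderiv_fourTangent, pderiv_fourTangent, pderiv_fourTangent, pderiv_fourTangent]
  simp only [Fin.isValue, show (1 : Fin 4) ≠ 0 by decide, show (2 : Fin 4) ≠ 0 by decide, show (2 : Fin 4) ≠ 1 by decide,
    show (3 : Fin 4) ≠ 0 by decide, show (3 : Fin 4) ≠ 1 by decide, show (3 : Fin 4) ≠ 2 by decide, ↓reduceIte]
  rw [hX 1, hX 0, h3q, h2sq, mul_zero, mul_zero, mul_zero, zero_add, zero_add, zero_add]

/-! ## The witness -/

/-- [OURS · L1 W4.6 rung (ii) at `p = 2`, `n = 4`; NOT a statement of the manuscript] **`u₀u₁ + u₂²u₃ + u₂u₃⁴`: AN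
ORDER-2-CLEANED FOURFOLD DOUBLE POINT OF CLASS `(2,2)` WITH ONE SATELLITE AND ONE FREE NEAR POINT.** The state is a
double point, order-2 cleaned, isolated, with `e = 2` and `h₂ = 2` (null-polar criterion: `polar(λ, v) = λ₃v₂²` on
the kernel); the chart `u₃` at the origin (near vector `e₃`, the double root of the kernel cubic `s²t`) gives a
double successor of corank `2`, isolated with smaller `μ` (SATELLITE); the chart `u₂` at the origin (near vector
`e₂`, the simple root) one of corank `0` (FREE: isolated, `μ = 1`, nothing after it). By p544683 there is no other
infinitely-near double point: the `(2,2)` line of the fourfold census with both bounds attained. [folklore] -/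
theorem fourTangent_near_points [CharP κ 2] {c : (Fin 4 → ℕ) → κ}
    (hc : ser 2 4 κ c = X 0 * X 1 + X 2 ^ 2 * X 3 + X 2 * X 3 ^ 4) :
    MultP 2 4 κ c ∧ OrdP 2 4 κ c ∧ Isol 2 4 κ c ∧ milnorEmbDim 2 4 κ c = 2 ∧ milnorHilbertTwo 2 4 κ c = 2 ∧
      (MultP 2 4 κ (step 2 4 κ 3 0 c) ∧ milnorEmbDim 2 4 κ (step 2 4 κ 3 0 c) = 2 ∧ Isol 2 4 κ (step 2 4 κ 3 0 c) ∧
        mu 2 4 κ (step 2 4 κ 3 0 c) < mu 2 4 κ c) ∧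
      (MultP 2 4 κ (step 2 4 κ 2 0 c) ∧ milnorEmbDim 2 4 κ (step 2 4 κ 2 0 c) = 0 ∧ Isol 2 4 κ (step 2 4 κ 2 0 c) ∧
        mu 2 4 κ (step 2 4 κ 2 0 c) = 1 ∧
          ∀ (i' : Fin 4) (τ' : Fin 4 → κ), ¬ MultP 2 4 κ (step 2 4 κ i' τ' (step 2 4 κ 2 0 c))) := by
  have hM := multP_of_ser_eq_fourTangent hc
  have hO := ordP_of_ser_eq_fourTangent hc
  have hI := isol_of_ser_eq_fourTangent hc
  have hker : ∀ v : Fin 4 → κ, v 0 = 0 → v 1 = 0 → Matrix.vecMul v (polarMatrix (ser 2 4 κ c)) = 0 := by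
    intro v h0 h1; rw [hc]; exact vecMul_polarMatrix_fourTangent_of_kernel v h0 h1
  have hcub : ∀ w : Fin 4 → κ, degForm 3 (ser 2 4 κ c) w = w 2 ^ 2 * w 3 := by
    intro w; rw [hc, degForm_three_fourTangent]
  have hpol : ∀ lam v : Fin 4 → κ, ∑ s, lam s * degForm 2 (MvPowerSeries.pderiv s (ser 2 4 κ c)) v = lam 3 * v 2 ^ 2 := by
    intro lam v; rw [hc, polar_fourTangent lam v]
  have hw₂ : Function.update (0 : Fin 4 → κ) 2 1 = Pi.single 2 1 := by
    funext s; fin_cases s <;> simp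
  have hw₃ : Function.update (0 : Fin 4 → κ) 3 1 = Pi.single 3 1 := by
    funext s; fin_cases s <;> simp
  -- the satellite successor (chart 3) gives `e = 2`
  have hM₃ : MultP 2 4 κ (step 2 4 κ 3 0 c) := by
    refine (hypersurface_multP_step_iff c 3 0 hM hI).mpr ⟨?_, ?_⟩
    · rw [hw₃]; exact hker _ (by simp) (by simp)
    · rw [hcub, hw₃]; simp
  have he : milnorEmbDim 2 4 κ c = 2 := fourfold_milnorEmbDim_eq_two_of_double_successor c 3 0 hM hO hM₃
  -- `h₂ = 2` by the null-polar criterion: `e₂` is a null polar, `polar(e₃, e₂) = 1`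
  have hh : milnorHilbertTwo 2 4 κ c = 2 := by
    refine (hypersurface_milnorHilbertTwo_eq_two_iff_null_polar_line c hM he).mpr
      ⟨⟨Pi.single 2 1, ?_, hker _ (by simp) (by simp), fun v _ => ?_⟩,
        ⟨Pi.single 3 1, Pi.single 2 1, hker _ (by simp) (by simp), hker _ (by simp) (by simp), ?_⟩⟩
    · intro h; have := congrFun h 2; simp at this
    · rw [hpol]; simp
    · rw [hpol]; simp
  -- the satellite has corank two; the free point corank zero
  have he₃ : milnorEmbDim 2 4 κ (step 2 4 κ 3 0 c) = 2 := by
    refine (hypersurface_milnorEmbDim_step_eq_two_iff c 3 0 hM he hM₃).mpr fun v _ => ?_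
    rw [hpol, hw₃]; simp
  have hM₂ : MultP 2 4 κ (step 2 4 κ 2 0 c) := by
    refine (hypersurface_multP_step_iff c 2 0 hM hI).mpr ⟨?_, ?_⟩
    · rw [hw₂]; exact hker _ (by simp) (by simp)
    · rw [hcub, hw₂]; simp
  have hfree : ∑ s, (Pi.single 3 1 : Fin 4 → κ) s * degForm 2 (MvPowerSeries.pderiv s (ser 2 4 κ c))
      (Function.update (0 : Fin 4 → κ) 2 1) ≠ 0 := by
    rw [hpol, hw₂]; simp
  have he₂ := (hypersurface_milnorEmbDim_step_eq_zero_iff c 2 0 hM he hM₂).mpr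
    ⟨Pi.single 3 1, hker _ (by simp) (by simp), hfree⟩
  exact ⟨hM, hO, hI, he, hh, ⟨hM₃, he₃, hypersurface_isol_step_of_milnorHilbertTwo_le_two c 3 0 hM hI he (by omega) hM₃⟩,
    ⟨hM₂, he₂, hypersurface_simple_tangent_resolved c 2 0 hM he hM₂ (hker _ (by simp) (by simp)) hfree⟩⟩

/-- [OURS · L1 W4.6 rung (ii) at `p = 2`, `n = 4`; NOT a statement of the manuscript] **THE FOURFOLD `(2,2)` CLASS IS
INHABITED**, over every field of characteristic `2`: there is an order-2-cleaned isolated double state of a fourfold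
hypersurface with `e = 2`, `h₂ = 2`, a satellite near double point (corank-two isolated successor, `μ` drops) and a
free one (corank `0`, `μ = 1`, nothing after) — non-vacuity of the `(2,2)` branch of `CampaignW46FourfoldsOrdTwoCensus`
and of `…HilbertTwoCount`, `…SuccessorDichotomy`, `…HilbertTwoIffNullPolarLine` at `n = 4`. [folklore] -/
theorem fourfold_multipleTangent_witness (κ : Type) [Field κ] [CharP κ 2] :
    ∃ c : (Fin 4 → ℕ) → κ, MultP 2 4 κ c ∧ OrdP 2 4 κ c ∧ Isol 2 4 κ c ∧ milnorEmbDim 2 4 κ c = 2 ∧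
      milnorHilbertTwo 2 4 κ c = 2 ∧
      (MultP 2 4 κ (step 2 4 κ 3 0 c) ∧ milnorEmbDim 2 4 κ (step 2 4 κ 3 0 c) = 2 ∧ Isol 2 4 κ (step 2 4 κ 3 0 c) ∧
        mu 2 4 κ (step 2 4 κ 3 0 c) < mu 2 4 κ c) ∧
      (MultP 2 4 κ (step 2 4 κ 2 0 c) ∧ milnorEmbDim 2 4 κ (step 2 4 κ 2 0 c) = 0 ∧ Isol 2 4 κ (step 2 4 κ 2 0 c) ∧
        mu 2 4 κ (step 2 4 κ 2 0 c) = 1 ∧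
          ∀ (i' : Fin 4) (τ' : Fin 4 → κ), ¬ MultP 2 4 κ (step 2 4 κ i' τ' (step 2 4 κ 2 0 c))) := by
  obtain ⟨c, hc⟩ := exists_ser_eq (X 0 * X 1 + X 2 ^ 2 * X 3 + X 2 * X 3 ^ 4 : MvPowerSeries (Fin 4) κ)
    fourTangent_coeff_eq_zero_of_even
  exact ⟨c, fourTangent_near_points hc⟩

end CampaignW46.HypersurfacesCharTwo

end Summit.ResolutionOfSingularities.ResolutionOfSingularities.Theorems

end
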